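import Mathlib
import HarnessLib
import Summits.QuantumAdvantage.QuantumAdvantage.Theses.AmplitudeProofs
import Literature.Computability.Complexity.Promise
import Literature.Computability.Cryptography.ClassBQP

/-!
# Birth skeleton for piece X₂ `ApcCertifiedCollapse` (split `np-cut` of crux `ApcThesis`, stmt-QuantumAdvantage-2697)

Piece X₂ = `PromiseBQP ∩ PromiseNP ⊆ PromiseP` (no quantum advantage on NP-certifiable promise problems; expected
FALSE — Shor).  Line "derandomization cut": the piece factors through textbook promise-BPP (`PromiseBPP'`, gap only
on the promise, `Literature/Computability/Complexity/Promise.lean`), separating its QUANTUM content from its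
PSEUDORANDOMNESS content:

* `stub_certifiedNoRandomizedAdvantage` (OPEN, expected false; the quantum core, strictly weaker than X₂):
  `PromiseBQP ∩ PromiseNP ⊆ PromiseBPP'` — every NP-certifiable promise problem decided by a uniform quantum
  family is decided by a probabilistic polynomial-time machine on the promise (factoring-type problems are the
  expected witnesses against it: Shor1997; it is NOT implied by `BQP ⊆ BPP`, promise vs language);
* `stub_promiseDerandomization` (OPEN, believed TRUE: `prBPP = prP`, Impagliazzo–Wigderson 1997 under
  `E ⊄ SIZE(2^{εn})`; AroraBarak2009 Thm 20.6/§20.1): `PromiseBPP' ⊆ PromiseP`;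
* `ApcCertifiedCollapse_of` (kernel-checked): composition of the two inclusions.
Sources: Shor1997; ImpagliazzoWigderson1997; AroraBarak2009 §20.1; Goldreich2006 Def 1.2 (promise-BPP).
-/

set_option linter.dupNamespace false

namespace Summit.QuantumAdvantage.QuantumAdvantage.Cruxes.ApcThesis.NpCut.CertifiedCollapse

open _root_.Computability Literature.Computability.Complexity Literature.Computability.Cryptography

/-- **stub 1 (OPEN, expected false; quantum core).** `PromiseBQP ∩ PromiseNP ⊆ PromiseBPP'`. -/
theorem stub_certifiedNoRandomizedAdvantage : Literature.Computability.Cryptography.PromiseBQP ∩ Literature.Computability.Complexity.PromiseNP ⊆ Literature.Computability.Complexity.PromiseBPP' := by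
  sorry

/-- **stub 2 (OPEN, believed true: prBPP = prP).** `PromiseBPP' ⊆ PromiseP`. -/
theorem stub_promiseDerandomization : Literature.Computability.Complexity.PromiseBPP' ⊆ Literature.Computability.Complexity.PromiseP := by
  sorry

/-- **Composition of the birth line** (kernel-checked): piece X₂ (stated verbatim; after the split it is the route
decl `Theses.AmplitudeProofs.ApcCertifiedCollapse`) from the two stubs BY NAME. -/
theorem ApcCertifiedCollapse_of : Literature.Computability.Cryptography.PromiseBQP ∩ Literature.Computability.Complexity.PromiseNP ⊆ Literature.Computability.Complexity.PromiseP :=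
  fun _Q hQ => stub_promiseDerandomization (stub_certifiedNoRandomizedAdvantage hQ)

end Summit.QuantumAdvantage.QuantumAdvantage.Cruxes.ApcThesis.NpCut.CertifiedCollapse
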